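import Mathlib
import HarnessLib
import Summits.HubbardSuperconductivity.HubbardSuperconductivity.Theorems.KLProgrammeKLRegimeTwoVolumeSrcSectorScaleSuccBundledP
import Summits.HubbardSuperconductivity.HubbardSuperconductivity.Theorems.KLProgrammeKLRegimeTwoVolumeFrameComposite
import Summits.HubbardSuperconductivity.HubbardSuperconductivity.Theorems.KLProgrammeKLRegimeTwoVolumeStepProfileKit
import Summits.HubbardSuperconductivity.HubbardSuperconductivity.Theorems.KLProgrammeKLRegimeTwoVolumeGluedTruncation
import Summits.HubbardSuperconductivity.HubbardSuperconductivity.Theorems.KLProgrammeKLRegimeTwoVolumeScaleSuccComposite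
import Summits.HubbardSuperconductivity.HubbardSuperconductivity.Theorems.KLProgrammeKLRegimeTwoVolumeSampledSliceData
import Summits.HubbardSuperconductivity.HubbardSuperconductivity.Theorems.KLProgrammeKLRegimeSliceSymbolTorus

/-!
# Route `KLProgramme` — crux K3, VL child `KLRegimeVolumeLimitV17F2` (stmt-HubbardSuperconductivity-20440), blueprint v5 M5: ONE SCALE OF THE NESTED TWO-VOLUME
# INDUCTION AT THE MODEL'S STEP COVARIANCES (seat hubbard-kl-k3c4-p1 g12; `--supports` 20440)

`…TwoVolumeScaleSuccComposite` (p595748) with the two step covariances INSTANTIATED at the programme's sector pull-backs of the zero-seed CT slice covariance at a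
common frame `K` (the coarse volume's top frame) on both lattices,
`CL_V = S_V(F̃_j[K])ᵀ · C^{K}_{(Λ_{j+2},Λ_{j+1}]}(V) · S_V(F̃_j[K])`, `V ∈ {L, L″}`: the sampled-family / sampled-symbol / normal-form hypotheses of the generic
step are discharged by `…TwoVolumeSampledSliceData` (p592543) and `…SliceSymbolTorus.hubbardCovSliceCT_eq_normalCovariance_sliceSymbolFnXi`.  The re-analysis
blocks stay abstract (periodisation hypothesis `hPT₀`: the caller passes the model's `T⁺_{j−1}[K]` with `sectorOverlap_periodise_leg`, or the identity at the
base), as do the fine volume's own-frame covariance `CLf″` and transfer (only their defect data enter).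

* **`model_sum_norm_kernel_twoVolume_scaleSucc_composite_le`**.

Proofs only; no definition.
-/

noncomputable section

namespace Summit.HubbardSuperconductivity.HubbardSuperconductivity.Theorems.TwoVolumeDefect

set_option linter.dupNamespace false -- summit = problem name (single-conjunct summit), D-0017

open Finset Literature.MathematicalPhysics.QuantumLattice GrassmannAlgebra Literature.Probability.LatticeModels
  Literature.Probability.LatticeModels.BattleFederbush
open Summit.HubbardSuperconductivity.HubbardSuperconductivity.Theorems.TwoPointAssembly
open Summit.HubbardSuperconductivity.HubbardSuperconductivity.Theorems.KLRegimeSplit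
open Summit.HubbardSuperconductivity.HubbardSuperconductivity.Theorems.KLProgrammeLegKernels
open Summit.HubbardSuperconductivity.HubbardSuperconductivity.Theorems.EngineV8
open Summit.HubbardSuperconductivity.HubbardSuperconductivity.Theorems.TorusFourierL2

set_option maxHeartbeats 400000 in -- one ~130-binder instantiation
/-- **ONE SCALE OF THE NESTED TWO-VOLUME INDUCTION AT THE MODEL'S STEP COVARIANCES** (composite form; see the module docstring).
[folklore: instantiation; cite: BenfattoGiulianiMastropietro2006, §2.7-§2.9 and §3; Salmhofer1999, §4.2.5 (4.70)] -/
theorem model_sum_norm_kernel_twoVolume_scaleSucc_composite_le {b L Lf M N₁ : ℕ} [NeZero Lf] [NeZero L] [NeZero M] (μ : ℝ) (K : TrigPolyC4v) (j : ℕ)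
    [LinearOrder ((SpaceTimeIdx Lf M × SectorLeg (sectorCount j)) × Fin 2)]
    (hLf : Lf = b * L) {β : ℝ} (hβ : β ≠ 0) {Λ : ℝ} (hΛ : 0 < Λ)
    -- the block structures of the scale-`j+1` and scale-`j` legs and their doublings
    (e : (SpaceTimeIdx Lf M × SectorLeg (sectorCount j)) ≃ (Fin 2 → Fin b) × (SpaceTimeIdx L M × SectorLeg (sectorCount j)))
    (he1 : ∀ X' i, ((e X').1 i : ℕ) = (X'.1.2 i).val / L) (he2 : ∀ X', (e X').2 = ((X'.1.1, fun i => (((X'.1.2 i).val : ℕ) : ZMod L)), X'.2))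
    (ed : ((SpaceTimeIdx Lf M × SectorLeg (sectorCount j)) × Fin 2) ≃ (Fin 2 → Fin b) × ((SpaceTimeIdx L M × SectorLeg (sectorCount j)) × Fin 2)) (hed : ∀ x s, ed (x, s) = ((e x).1, ((e x).2, s)))
    (e₁ : (SpaceTimeIdx Lf M × SectorLeg N₁) ≃ (Fin 2 → Fin b) × (SpaceTimeIdx L M × SectorLeg N₁))
    (he₁1 : ∀ X' i, ((e₁ X').1 i : ℕ) = (X'.1.2 i).val / L) (he₁2 : ∀ X', (e₁ X').2 = ((X'.1.1, fun i => (((X'.1.2 i).val : ℕ) : ZMod L)), X'.2))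
    (ed₁ : ((SpaceTimeIdx Lf M × SectorLeg N₁) × Fin 2) ≃ (Fin 2 → Fin b) × ((SpaceTimeIdx L M × SectorLeg N₁) × Fin 2)) (hed₁ : ∀ x s, ed₁ (x, s) = ((e₁ x).1, ((e₁ x).2, s)))
    -- THE MODEL'S STEP COVARIANCES at frame `K` on both lattices: `S(F̃_j[K])ᵀ · C^K_{(Λ_{j+2},Λ_{j+1}]} · S(F̃_j[K])`, and their spectator lifts
    (CL : Matrix (SpaceTimeIdx L M × SectorLeg (sectorCount j)) (SpaceTimeIdx L M × SectorLeg (sectorCount j)) ℂ)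
    (hCL : CL = (sectorSubMatrix L M β (bgmFatMultiplier L M klE0 β (nambuXiCT L μ K) j)).transpose *
      hubbardCovSliceCT L M β μ 0 K (klScale klE0 (j + 2)) (klScale klE0 (j + 1)) * sectorSubMatrix L M β (bgmFatMultiplier L M klE0 β (nambuXiCT L μ K) j))
    (CLf : Matrix (SpaceTimeIdx Lf M × SectorLeg (sectorCount j)) (SpaceTimeIdx Lf M × SectorLeg (sectorCount j)) ℂ)
    (hCLf : CLf = (sectorSubMatrix Lf M β (bgmFatMultiplier Lf M klE0 β (nambuXiCT Lf μ K) j)).transpose *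
      hubbardCovSliceCT Lf M β μ 0 K (klScale klE0 (j + 2)) (klScale klE0 (j + 1)) * sectorSubMatrix Lf M β (bgmFatMultiplier Lf M klE0 β (nambuXiCT Lf μ K) j))
    (Cd : Matrix ((SpaceTimeIdx L M × SectorLeg (sectorCount j)) × Fin 2) ((SpaceTimeIdx L M × SectorLeg (sectorCount j)) × Fin 2) ℂ) (hCd : ∀ p q, Cd p q = if p.2 = 0 ∧ q.2 = 0 then CL p.1 q.1 else 0)
    (Cd' : Matrix ((SpaceTimeIdx Lf M × SectorLeg (sectorCount j)) × Fin 2) ((SpaceTimeIdx Lf M × SectorLeg (sectorCount j)) × Fin 2) ℂ) (hCd' : ∀ p q, Cd' p q = if p.2 = 0 ∧ q.2 = 0 then CLf p.1 q.1 else 0)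
    -- the re-analysis blocks `T_V` related by periodisation, the source relabellings `J_V`, the block substitutions `T⁺_V`
    (Tc : Matrix (SpaceTimeIdx L M × SectorLeg (sectorCount j)) (SpaceTimeIdx L M × SectorLeg N₁) ℂ)
    (Tf : Matrix (SpaceTimeIdx Lf M × SectorLeg (sectorCount j)) (SpaceTimeIdx Lf M × SectorLeg N₁) ℂ)
    (hPT₀ : ∀ (X' : (SpaceTimeIdx Lf M × SectorLeg (sectorCount j))) (Y : (SpaceTimeIdx L M × SectorLeg N₁)),
      ∑ Y'' ∈ univ.filter (fun Y'' : (SpaceTimeIdx Lf M × SectorLeg N₁) => (e₁ Y'').2 = Y), Tf X' Y'' = Tc (e X').2 Y)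
    (Jc : Matrix (SpaceTimeIdx L M × SectorLeg (sectorCount j)) (SpaceTimeIdx L M × SectorLeg N₁) ℂ) (Jf : Matrix (SpaceTimeIdx Lf M × SectorLeg (sectorCount j)) (SpaceTimeIdx Lf M × SectorLeg N₁) ℂ)
    (hPJ : ∀ (X' : (SpaceTimeIdx Lf M × SectorLeg (sectorCount j))) (Y : (SpaceTimeIdx L M × SectorLeg N₁)),
      ∑ Y'' ∈ univ.filter (fun Y'' : (SpaceTimeIdx Lf M × SectorLeg N₁) => (e₁ Y'').2 = Y), Jf X' Y'' = Jc (e X').2 Y)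
    (Tpc : Matrix ((SpaceTimeIdx L M × SectorLeg (sectorCount j)) × Fin 2) ((SpaceTimeIdx L M × SectorLeg N₁) × Fin 2) ℂ)
    (hTpc : ∀ p' p, Tpc p' p = if p'.2 = 0 ∧ p.2 = 0 then Tc p'.1 p.1 else if p'.2 = 1 ∧ p.2 = 1 then Jc p'.1 p.1 else 0)
    (Tpf : Matrix ((SpaceTimeIdx Lf M × SectorLeg (sectorCount j)) × Fin 2) ((SpaceTimeIdx Lf M × SectorLeg N₁) × Fin 2) ℂ)
    (hTpf : ∀ p' p, Tpf p' p = if p'.2 = 0 ∧ p.2 = 0 then Tf p'.1 p.1 else if p'.2 = 1 ∧ p.2 = 1 then Jf p'.1 p.1 else 0)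
    -- the region schedule: zone depth `R`, extra pin depth `R′`, transfer radii `RN ≤ RZ`, `RF`, tail radius `r` (`r ≤ RN`, `r ≤ RF`, `r + RZ ≤ R`); the pin
    (R R' RN RZ RF r : ℕ) (hNZ : RN ≤ RZ) (hrN : r ≤ RN) (hrF : r ≤ RF) (hrZR : r + RZ ≤ R)
    (w : ((SpaceTimeIdx Lf M × SectorLeg (sectorCount j)) × Fin 2)) (hw : ∀ j, R + R' ≤ (w.1.1.2 j).val % L ∧ (w.1.1.2 j).val % L + (R + R') < L)
    -- ONE-VOLUME COVARIANCE DATA (bundled), both volumes; the fine sectional row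
    {κ κ' αW αW' sW sW' eW' : ℝ} (hC : ScaleCovData CL Λ κ αW sW) (hC' : ScaleCovData CLf Λ κ' αW' sW') (hCsec : ScaleCovSecData CLf Λ eW')
    -- ONE-VOLUME TRANSFER DATA of `T⁺_{L″}` (bundled)
    {ΛT cW : ℝ} (hTr : TransferWtData Tpf ed ed₁ ΛT cW)
    -- the two DOUBLED scale-`j` actions (parity, no constant part) and their ONE-VOLUME profiles: the coarse previous action at its own rate `Λ₁` (raw degree),
    -- the two re-analysed inputs at rate `Λ` (the engine's sub-diagonal read-outs), the coarse step's field radius `ρ₀` and its smallness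
    (𝒲 : GrassmannAlgebra ℂ ((SpaceTimeIdx L M × SectorLeg N₁) × Fin 2)) (h𝒲e : 𝒲 ∈ evenOdd ℂ 0) (h𝒲0 : constPart ℂ 𝒲 = 0)
    (𝒲' : GrassmannAlgebra ℂ ((SpaceTimeIdx Lf M × SectorLeg N₁) × Fin 2)) (h𝒲'e : 𝒲' ∈ evenOdd ℂ 0) (h𝒲'0 : constPart ℂ 𝒲' = 0)
    {Λ₁ : ℝ} (hΛ₁ : 0 ≤ Λ₁) (N𝒲 NV NW' : ℕ → ℝ) (hN𝒲 : WtProfileRaw 𝒲 Λ₁ N𝒲)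
    (hNV : WtProfileEven (ExteriorAlgebra.map (Matrix.toLin' Tpc) 𝒲) Λ NV)
    -- the fine previous own-frame action's raw weighted profile; the HYBRID re-analysis profile is derived (`…StepProfileKit`)
    (N𝒲' : ℕ → ℝ) (hN𝒲' : WtProfileRaw 𝒲' Λ₁ N𝒲') (hΛT : Λ ≤ ΛT) (hΛΛ₁ : Λ ≤ Λ₁)
    (hNW'def : ∀ m', NW' m' = cW ^ (2 * m' - 1) * (cW * N𝒲' (2 * m')))
    {ρ₀ : ℝ} (hρ₀ : 0 < ρ₀) (hθ₀ : Real.exp 1 * αW * normV ((SpaceTimeIdx L M × SectorLeg (sectorCount j)) × Fin 2) κ ρ₀ NV / κ ^ 2 < 1)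
    (Nw : ℕ → ℝ) (hNwdef : ∀ m', Nw m' = ρ₀⁻¹ ^ (2 * m') * (Real.exp 1 * normV ((SpaceTimeIdx L M × SectorLeg (sectorCount j)) × Fin 2) κ ρ₀ NV) / (1 - Real.exp 1 * αW * normV ((SpaceTimeIdx L M × SectorLeg (sectorCount j)) × Fin 2) κ ρ₀ NV / κ ^ 2))
    -- the other field radii and the smallness conditions of the two-volume step (α = m₁ = s := αW, primed := αW′)
    {ρf : ℝ} (hρf : 0 < ρf)
    (hθw : Real.exp 1 * (αW' + αW + (αW' + αW)) * normV ((SpaceTimeIdx Lf M × SectorLeg (sectorCount j)) × Fin 2) (κ' + κ) ρf Nw / (κ' + κ) ^ 2 < 1)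
    {ρ₂ : ℝ} (hρ₂ : 0 < ρ₂)
    (hθ₂ : Real.exp 1 * (αW' + αW + (αW' + αW)) * normV ((SpaceTimeIdx Lf M × SectorLeg (sectorCount j)) × Fin 2) (κ' + κ + (κ' + κ + (κ' + κ))) ρ₂ Nw /
      (κ' + κ + (κ' + κ + (κ' + κ))) ^ 2 < 1)
    -- the scale-`j` TWO-VOLUME data (induction hypothesis) in block-reduced form, the transfer majorant `Ein` with `aT := cW`, `τT := cW/(1+Λ_T(r+1))`,
    -- `Nj := N𝒲`, `Nfarj := N𝒲/(1+Λ₁(RZ−RN+1))`, its cap, and the two smallness conditions of the interaction bracket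
    (Ej NDj : ℕ → ℝ) (hD : KeyedDefectData (N := sectorCount j) ed₁ 𝒲' 𝒲 R RF Ej NDj)
    (Ein : ℕ → ℝ) (hEin0 : ∀ m', 0 ≤ Ein m')
    (hEin : ∀ m', 1 ≤ m' → ∀ n : ℕ, 2 * m' = n + 1 →
      cW ^ n * (cW * Ej (n + 1) + cW / (1 + ΛT * ((r : ℝ) + 1)) * NDj (n + 1)) +
        (2 * cW ^ n * (cW / (1 + ΛT * ((r : ℝ) + 1))) * N𝒲 (n + 1) +
          n * cW ^ n * (5 * (cW / (1 + ΛT * ((r : ℝ) + 1))) * N𝒲 (n + 1) + 2 * cW * ((1 + Λ₁ * (((RZ - RN : ℕ) : ℝ) + 1))⁻¹ * N𝒲 (n + 1)))) ≤ Ein m')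
    {ρ' : ℝ} (hρ' : 0 < ρ') {νEbar : ℝ} (hνE : normV ((SpaceTimeIdx Lf M × SectorLeg (sectorCount j)) × Fin 2) κ' ρ' Ein ≤ νEbar)
    (hbar : Real.exp 1 * αW' * (normV ((SpaceTimeIdx Lf M × SectorLeg (sectorCount j)) × Fin 2) κ' ρ' (fun m' => NV m' + (NW' m' + NV m')) + νEbar) / κ' ^ 2 < 1)
    (hθ₂' : Real.exp 1 * αW' * (normV ((SpaceTimeIdx Lf M × SectorLeg (sectorCount j)) × Fin 2) κ' ρ' NV + normV ((SpaceTimeIdx Lf M × SectorLeg (sectorCount j)) × Fin 2) κ' ρ' (fun m' => NW' m' + NV m')) / κ' ^ 2 < 1)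
    -- THE FINE VOLUME'S OWN-FRAME STEP (blueprint M3f): covariance `C⁺[K″]` (spectator lift of `CLf″`) and transfer `T⁺[K″]` on `L″`, the Gram constant of the
    -- frame path, the entry sup / rows / columns of the covariance defect `CLf″ − CLf`, the rows / columns of the transfer defect, one field radius, two smallness lines
    (CLf'' : Matrix (SpaceTimeIdx Lf M × SectorLeg (sectorCount j)) (SpaceTimeIdx Lf M × SectorLeg (sectorCount j)) ℂ)
    (Cd'' : Matrix ((SpaceTimeIdx Lf M × SectorLeg (sectorCount j)) × Fin 2) ((SpaceTimeIdx Lf M × SectorLeg (sectorCount j)) × Fin 2) ℂ)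
    (hCd'' : ∀ p q, Cd'' p q = if p.2 = 0 ∧ q.2 = 0 then CLf'' p.1 q.1 else 0)
    (Tpf'' : Matrix ((SpaceTimeIdx Lf M × SectorLeg (sectorCount j)) × Fin 2) ((SpaceTimeIdx Lf M × SectorLeg N₁) × Fin 2) ℂ)
    {κf sE cR cC δ ρ₃ : ℝ} (hκf : 0 < κf) (hGBf : ∀ t ∈ Set.Icc (0 : ℝ) 1, IsGramBoundedR (CLf + t • (CLf'' - CLf)) κf)
    (hsE0 : 0 ≤ sE) (hsE : ∀ x y, ‖(CLf'' - CLf) x y‖ ≤ sE) (hcR : 0 ≤ cR) (hcC : 0 ≤ cC)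
    (hER : ∀ x, ∑ y, ‖(CLf'' - CLf) x y‖ ≤ cR) (hEC : ∀ y, ∑ x, ‖(CLf'' - CLf) x y‖ ≤ cC)
    (hδ : 0 ≤ δ) (hδrow : ∀ x, ∑ y, ‖Tpf'' x y - Tpf x y‖ ≤ δ) (hδcol : ∀ y, ∑ x, ‖Tpf'' x y - Tpf x y‖ ≤ δ)
    (NB : ℕ → ℝ) (hNBdef : ∀ m', NB m' = (2 * m' : ℕ) * (cW + δ) ^ (2 * m' - 1) * δ * N𝒲' (2 * m')) (hρ₃ : 0 < ρ₃)
    (hθf₁ : Real.exp 1 * (αW' + (cR + cC)) * normV ((SpaceTimeIdx Lf M × SectorLeg (sectorCount j)) × Fin 2) κf ρ₃ (fun m' => NW' m' + NB m') / κf ^ 2 < 1)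
    (hθf₂ : Real.exp 1 * αW' * (normV ((SpaceTimeIdx Lf M × SectorLeg (sectorCount j)) × Fin 2) κf ρ₃ NW' + normV ((SpaceTimeIdx Lf M × SectorLeg (sectorCount j)) × Fin 2) κf ρ₃ NB) / κf ^ 2 < 1)
    (n : ℕ) (p : Fin (n + 1)) :
    ∑ X ∈ univ.filter (fun X : Fin (n + 1) → ((SpaceTimeIdx Lf M × SectorLeg (sectorCount j)) × Fin 2) => X p = w),
        ‖kernel ℂ (effAction ℂ Cd'' (ExteriorAlgebra.map (Matrix.toLin' Tpf'') 𝒲')) (n + 1) X -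
          (if ∀ i, (ed (X i)).1 = (ed (X p)).1 then
            kernel ℂ (effAction ℂ Cd (ExteriorAlgebra.map (Matrix.toLin' Tpc) 𝒲)) (n + 1) (fun i => (ed (X i)).2) else 0)‖ ≤
      (((((n + 1 + 1) * (n + 1 + 2) : ℕ) : ℝ) / 2 * sE *
          (ρ₃⁻¹ ^ (n + 3) * (Real.exp 1 * normV ((SpaceTimeIdx Lf M × SectorLeg (sectorCount j)) × Fin 2) κf ρ₃ (fun m' => NW' m' + NB m')) /
            (1 - Real.exp 1 * (αW' + (cR + cC)) * normV ((SpaceTimeIdx Lf M × SectorLeg (sectorCount j)) × Fin 2) κf ρ₃ (fun m' => NW' m' + NB m') / κf ^ 2)) +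
        ‖(2 : ℂ)⁻¹‖ * ∑ a' ∈ range (n + 2), ∑ b' ∈ range (n + 2),
          (if a' + b' = n + 1 then (((a' + 1) * (b' + 1) : ℕ) : ℝ) *
            (cR * (ρ₃⁻¹ ^ (a' + 1) * (Real.exp 1 * normV ((SpaceTimeIdx Lf M × SectorLeg (sectorCount j)) × Fin 2) κf ρ₃ (fun m' => NW' m' + NB m')) /
                  (1 - Real.exp 1 * (αW' + (cR + cC)) * normV ((SpaceTimeIdx Lf M × SectorLeg (sectorCount j)) × Fin 2) κf ρ₃ (fun m' => NW' m' + NB m') / κf ^ 2)) *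
                (ρ₃⁻¹ ^ (b' + 1) * (Real.exp 1 * normV ((SpaceTimeIdx Lf M × SectorLeg (sectorCount j)) × Fin 2) κf ρ₃ (fun m' => NW' m' + NB m')) /
                  (1 - Real.exp 1 * (αW' + (cR + cC)) * normV ((SpaceTimeIdx Lf M × SectorLeg (sectorCount j)) × Fin 2) κf ρ₃ (fun m' => NW' m' + NB m') / κf ^ 2)) +
              cC * (ρ₃⁻¹ ^ (a' + 1) * (Real.exp 1 * normV ((SpaceTimeIdx Lf M × SectorLeg (sectorCount j)) × Fin 2) κf ρ₃ (fun m' => NW' m' + NB m')) /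
                  (1 - Real.exp 1 * (αW' + (cR + cC)) * normV ((SpaceTimeIdx Lf M × SectorLeg (sectorCount j)) × Fin 2) κf ρ₃ (fun m' => NW' m' + NB m') / κf ^ 2)) *
                (ρ₃⁻¹ ^ (b' + 1) * (Real.exp 1 * normV ((SpaceTimeIdx Lf M × SectorLeg (sectorCount j)) × Fin 2) κf ρ₃ (fun m' => NW' m' + NB m')) /
                  (1 - Real.exp 1 * (αW' + (cR + cC)) * normV ((SpaceTimeIdx Lf M × SectorLeg (sectorCount j)) × Fin 2) κf ρ₃ (fun m' => NW' m' + NB m') / κf ^ 2))) else 0)) +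
      ρ₃⁻¹ ^ (n + 1) * (Real.exp 1 * normV ((SpaceTimeIdx Lf M × SectorLeg (sectorCount j)) × Fin 2) κf ρ₃ NB) / (1 - Real.exp 1 * αW' * (normV ((SpaceTimeIdx Lf M × SectorLeg (sectorCount j)) × Fin 2) κf ρ₃ NW' + normV ((SpaceTimeIdx Lf M × SectorLeg (sectorCount j)) × Fin 2) κf ρ₃ NB) / κf ^ 2) ^ 2) +
      ((ρ'⁻¹ ^ (n + 1) * Real.exp 1 / (1 - Real.exp 1 * αW' * (normV ((SpaceTimeIdx Lf M × SectorLeg (sectorCount j)) × Fin 2) κ' ρ' (fun m' => NV m' + (NW' m' + NV m')) + νEbar) / κ' ^ 2) ^ 2) * normV ((SpaceTimeIdx Lf M × SectorLeg (sectorCount j)) × Fin 2) κ' ρ' Ein +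
        (ρ'⁻¹ ^ (n + 1) * (Real.exp 1 * normV ((SpaceTimeIdx Lf M × SectorLeg (sectorCount j)) × Fin 2) κ' ρ' (fun m' => NW' m' + NV m')) / (1 - Real.exp 1 * αW' * (normV ((SpaceTimeIdx Lf M × SectorLeg (sectorCount j)) × Fin 2) κ' ρ' NV + normV ((SpaceTimeIdx Lf M × SectorLeg (sectorCount j)) × Fin 2) κ' ρ' (fun m' => NW' m' + NV m')) / κ' ^ 2) ^ 2) * (1 + Λ * ((R' : ℝ) + 1))⁻¹ +
        ((((n + 1 + 1) * (n + 1 + 2) : ℕ) : ℝ) / 2 *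
            (ρ₂⁻¹ ^ (n + 3) * (Real.exp 1 * normV ((SpaceTimeIdx Lf M × SectorLeg (sectorCount j)) × Fin 2) (κ' + κ + (κ' + κ + (κ' + κ))) ρ₂ Nw) / (1 - Real.exp 1 * (αW' + αW + (αW' + αW)) * normV ((SpaceTimeIdx Lf M × SectorLeg (sectorCount j)) × Fin 2) (κ' + κ + (κ' + κ + (κ' + κ))) ρ₂ Nw / (κ' + κ + (κ' + κ + (κ' + κ))) ^ 2))) * (eW' / (1 + Λ * ((R : ℝ) + 1))) +
        (‖(2 : ℂ)⁻¹‖ * ∑ a ∈ range (n + 2), ∑ b ∈ range (n + 2),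
            (if a + b = n + 1 then (((a + 1) * (b + 1) : ℕ) : ℝ) *
              (4 * (ρ₂⁻¹ ^ (a + 1) * (Real.exp 1 * normV ((SpaceTimeIdx Lf M × SectorLeg (sectorCount j)) × Fin 2) (κ' + κ + (κ' + κ + (κ' + κ))) ρ₂ Nw) / (1 - Real.exp 1 * (αW' + αW + (αW' + αW)) * normV ((SpaceTimeIdx Lf M × SectorLeg (sectorCount j)) × Fin 2) (κ' + κ + (κ' + κ + (κ' + κ))) ρ₂ Nw / (κ' + κ + (κ' + κ + (κ' + κ))) ^ 2)) *
                (ρ₂⁻¹ ^ (b + 1) * (Real.exp 1 * normV ((SpaceTimeIdx Lf M × SectorLeg (sectorCount j)) × Fin 2) (κ' + κ + (κ' + κ + (κ' + κ))) ρ₂ Nw) / (1 - Real.exp 1 * (αW' + αW + (αW' + αW)) * normV ((SpaceTimeIdx Lf M × SectorLeg (sectorCount j)) × Fin 2) (κ' + κ + (κ' + κ + (κ' + κ))) ρ₂ Nw / (κ' + κ + (κ' + κ + (κ' + κ))) ^ 2))) else 0)) * (αW' / (1 + Λ * ((R : ℝ) + 1))) +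
        ((((n + 1 + 1) * (n + 1 + 2) : ℕ) : ℝ) / 2 * (sW' + sW) *
              (ρf⁻¹ ^ (n + 3) * (Real.exp 1 * normV ((SpaceTimeIdx Lf M × SectorLeg (sectorCount j)) × Fin 2) (κ' + κ) ρf Nw) / (1 - Real.exp 1 * (αW' + αW + (αW' + αW)) * normV ((SpaceTimeIdx Lf M × SectorLeg (sectorCount j)) × Fin 2) (κ' + κ) ρf Nw / (κ' + κ) ^ 2)) +
            ‖(2 : ℂ)⁻¹‖ * ∑ a ∈ range (n + 2), ∑ b ∈ range (n + 2),
              (if a + b = n + 1 then (((a + 1) * (b + 1) : ℕ) : ℝ) *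
                (2 * (αW' + αW) * (ρf⁻¹ ^ (a + 1) * (Real.exp 1 * normV ((SpaceTimeIdx Lf M × SectorLeg (sectorCount j)) × Fin 2) (κ' + κ) ρf Nw) / (1 - Real.exp 1 * (αW' + αW + (αW' + αW)) * normV ((SpaceTimeIdx Lf M × SectorLeg (sectorCount j)) × Fin 2) (κ' + κ) ρf Nw / (κ' + κ) ^ 2)) *
                  (ρf⁻¹ ^ (b + 1) * (Real.exp 1 * normV ((SpaceTimeIdx Lf M × SectorLeg (sectorCount j)) × Fin 2) (κ' + κ) ρf Nw) / (1 - Real.exp 1 * (αW' + αW + (αW' + αW)) * normV ((SpaceTimeIdx Lf M × SectorLeg (sectorCount j)) × Fin 2) (κ' + κ) ρf Nw / (κ' + κ) ^ 2))) else 0)) * (Λ * ((R' : ℝ) + 1))⁻¹) := by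
  classical
  -- the sampled fat family, the sampled slice symbol, the normal form of the slice covariance
  have hCL' : CL = (sectorSubMatrix L M β (bgmFatMultiplier L M klE0 β (nambuXiCT L μ K) j)).transpose *
      normalCovariance L M (fun ks : FreqMomentum L M × Fin 2 =>
        sliceSymbolFnXi (β * (L : ℝ) ^ 2) 0 (klScale klE0 (j + 2)) (klScale klE0 (j + 1)) (matsubaraFreq β M ks.1.1) (nambuXiCT L μ K ks.1.2)) *
      sectorSubMatrix L M β (bgmFatMultiplier L M klE0 β (nambuXiCT L μ K) j) := by
    rw [hCL, hubbardCovSliceCT_eq_normalCovariance_sliceSymbolFnXi hβ]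
  have hCLf' : CLf = (sectorSubMatrix Lf M β (bgmFatMultiplier Lf M klE0 β (nambuXiCT Lf μ K) j)).transpose *
      normalCovariance Lf M (fun ks : FreqMomentum Lf M × Fin 2 =>
        sliceSymbolFnXi (β * (Lf : ℝ) ^ 2) 0 (klScale klE0 (j + 2)) (klScale klE0 (j + 1)) (matsubaraFreq β M ks.1.1) (nambuXiCT Lf μ K ks.1.2)) *
      sectorSubMatrix Lf M β (bgmFatMultiplier Lf M klE0 β (nambuXiCT Lf μ K) j) := by
    rw [hCLf, hubbardCovSliceCT_eq_normalCovariance_sliceSymbolFnXi hβ]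
  exact srcSector_sum_norm_kernel_twoVolume_scaleSucc_composite_le hLf hβ hΛ e he1 he2 ed hed e₁ he₁1 he₁2 ed₁ hed₁
    (fun (ω' : Fin (sectorCount j)) (i' : MatsubaraIdx M) (p : Fin 2 → ℝ) =>
      (((gnScaleCutoff 4 klE0 (-(j : ℤ) + 1) (Real.sqrt (matsubaraFreq β M i' ^ 2 + (-2 * ∑ l, Real.cos (p l) - μ - K.eval p) ^ 2)) *
          ∑ ω'' ∈ (range (sectorCount j)).filter
            (fun ω'' : ℕ => ∃ δ : ℤ, |δ| ≤ 1 ∧ (sectorCount j : ℤ) ∣ ((ω'' : ℤ) - ((ω' : ℕ) : ℤ) - δ)),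
            sectorWeightCirc j ω'' (polarAngle (fun l => toIocMod Real.two_pi_pos (-Real.pi) (p l))) : ℝ) : ℂ)))
    (fun (i' : MatsubaraIdx M) (_ : Fin 2) (p : Fin 2 → ℝ) =>
      (sliceWeightFn (klScale klE0 (j + 2)) (klScale klE0 (j + 1)) (matsubaraFreq β M i') (-2 * ∑ l, Real.cos (p l) - μ - K.eval p) : ℂ) /
        (-Complex.I * (((matsubaraFreq β M i' + 0 : ℝ)) : ℂ) + (((-2 * ∑ l, Real.cos (p l) - μ - K.eval p : ℝ)) : ℂ)))
    (bgmFatMultiplier L M klE0 β (nambuXiCT L μ K) j) (bgmFatMultiplier Lf M klE0 β (nambuXiCT Lf μ K) j)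
    (fun ω i q => bgmFatMultiplier_nambuXiCT_eq_sampled klE0 β μ K j ω i q) (fun ω i q => bgmFatMultiplier_nambuXiCT_eq_sampled klE0 β μ K j ω i q)
    _ _ (fun i q σ => sliceSymbolFnXi_nambuXiCT_eq_sampled β μ K _ _ i q σ) (fun i q σ => sliceSymbolFnXi_nambuXiCT_eq_sampled β μ K _ _ i q σ)
    CL hCL' CLf hCLf' Cd hCd Cd' hCd' Tc Tf hPT₀ Jc Jf hPJ Tpc hTpc Tpf hTpf R R' RN RZ RF r hNZ hrN hrF hrZR w hw hC hC' hCsec hTr 𝒲 h𝒲e h𝒲0 𝒲' h𝒲'e h𝒲'0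
    hΛ₁ N𝒲 NV NW' hN𝒲 hNV N𝒲' hN𝒲' hΛT hΛΛ₁ hNW'def hρ₀ hθ₀ Nw hNwdef hρf hθw hρ₂ hθ₂ Ej NDj hD Ein hEin0 hEin hρ' hνE hbar hθ₂' CLf'' Cd'' hCd'' Tpf''
    hκf hGBf hsE0 hsE hcR hcC hER hEC hδ hδrow hδcol NB hNBdef hρ₃ hθf₁ hθf₂ n p

end Summit.HubbardSuperconductivity.HubbardSuperconductivity.Theorems.TwoVolumeDefect

end
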